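import Summits.BirchSwinnertonDyer.BirchSwinnertonDyer.Theorems.ThetaPartnerAtTwoSignedMainConjectureCMTwoRankZeroFlatTwistFamily
import HarnessLib

/-!
# Route `ThetaPartnerAtTwo`, crux K2r0P `SignedMainConjectureCMTwoRankZeroOfPub` (stmt-BirchSwinnertonDyer-24945),
# line `rankzero` v14/v15, stub (μ♭)_A: the family node FROM SIBLINGS — one rank-`0` member per anchor carrying a
# plus certificate (e.g. a UNIT-ZONE member, from print) certifies (μ♭) on the whole `j`-family

Cell `bsd-wall`, width seat `bsd-wall-tp2-p2-w4` (g7). THEOREMS ONLY (no `def`, no named fact, no `sorry`); helper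
`--supports` the crux; sequel of `…FlatTwistFamily` (namespace `…Theorems.FlatTwist.Family`). There the family node
`analyticMuFlat_of_j_eq` asks, at each anchor `W`, `W′` of conductor `p²`, for ONE modular-symbol certificate of the sign
`w(W)` (plus certificate «some `[b/4^k]⁺_{f_W} − [0]⁺_{f_W}` is half an odd integer» if `w = +1`, minus certificate «some
`2[b/4^k]⁻_{f_W}` is odd» if `w = −1`). Here the certificate is moved to ANY rank-`0` member of the family:

* §1 `certificates_of_sibling` — a plus certificate at a good-at-`2` square-free sibling `A₁ = C₁ • W^{(d₁)}` (`(d₁, N_W) = 1`,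
  EITHER sign, `d₁ ≡ 1 (mod 4)` derived) gives the plus certificate at `W` if `d₁ > 0` (`exists_odd_of_exists_odd_twist`) and
  the minus certificate at `W` if `d₁ < 0` (`exists_oddMinus_of_exists_odd_negTwist_squarefree`, H⁻(W) from Abbes–Ullmo);
  `rootNumber_certificates_of_sibling` — if moreover `N_W` is a square and `L(A₁,1) ≠ 0` then `sign d₁ = w(W)`, so the
  sibling's certificate is exactly the one the family node asks for;
* §2 `analyticMuFlat_of_j_eq_of_siblings` — THE FAMILY NODE FROM SIBLINGS: anchor pair `(W, W′ = W^{(±p)})` of conductor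
  `p²` (good supersingular at `2`, `a₂ = 0`, `Δ < 0`, `j ≠ 0, 1728`), and for each anchor ONE rank-`0` good-at-`2` square-free
  sibling (twist parameter prime to `p`) with a plus certificate ⟹ (μ♭) at every globally minimal `A` with `j(A) = j(W)`,
  good at `2`, `L(A,1) ≠ 0`;
* §3 `analyticMuFlat_family_of_pub_of_unitZone_siblings` — FROM PRINT: the siblings' certificates supplied by the UNIT
  ZONE (`FlatTwist.exists_odd_of_unitZone`: CM, analytic rank `0`, `2 ∤ #Ш·∏c_ℓ`, granted `hBF hLrat hGZK` and the period
  unit, here from Abbes–Ullmo), conclusion = the registered stub `stub_analyticMuFlatNonUnitCMTwo` restricted to the family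
  `j(A) = j(W)`. Reading: on a sporadic CM family (`p = 11, 19, 43, 67, 163`) FLAT at ALL conductors follows from print
  (`hBF hmod hLrat hGZK hAU`) plus the BSD data (`#Ш`, Tamagawa numbers — odd) of ONE rank-`0` member twisted from `W` by a
  parameter prime to `p` and ONE twisted from `W′`; no modular-symbol numerics at all.

Nothing about any particular curve is asserted; no certificate is computed here; (μ♭) class-wide stays open (the `j = 0`
tail); BSD is not proved by any of this.

References: Silverman *AEC* (2009) X.5 Prop. 5.4 [SilvermanAEC2009]; Barrios–Roy–Sahajpal–Tallana–Tobin–Wiersema, Res.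
Number Theory 11 (2025) Thm. 5.1 [BarriosEtAl2025]; Murty–Murty (1997) Ch. 6 §1 [MurtyMurty1997]; Mazur–Tate–Teitelbaum,
Invent. Math. 84 (1986) §I.8 [MazurTateTeitelbaum1986Invent]; Pal, Proc. AMS 140 (2012) Thm. 3.2 [Pal2012]; Burungale–Flach,
Camb. J. Math. (2024) Thm. 1.1 [BurungaleFlach2024]; Abbes–Ullmo, Compositio Math. 103 (1996) Thm. A [AbbesUllmo1996];
Pollack, Duke Math. J. 118 (2003) Prop. 6.18 [Pollack2003].
-/

set_option autoImplicit false
-- the Theorems namespace of this sub repeats the summit name by design (D-0017 nested layout)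
set_option linter.dupNamespace false

noncomputable section

open scoped Classical MatrixGroups ModularForm NumberField NumberTheorySymbols

open NumberField IsDedekindDomain Rat.HeightOneSpectrum CongruenceSubgroup
  Literature.NumberTheory.EllipticCurves Literature.NumberTheory.GaloisRepresentations
  WeierstrassCurve Literature.NumberTheory.EllipticCurves.ModularForms Literature.NumberTheory.EllipticCurves.Rank1Residual
  Literature.NumberTheory.EllipticCurves.Rank1Residual.Typed
  Summit.BirchSwinnertonDyer.Rank1Residual Summit.BirchSwinnertonDyer.Rank1Residual.Supersingular

namespace Summit.BirchSwinnertonDyer.BirchSwinnertonDyer.Theorems.FlatTwist.Family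

/-! ## §1. Certificates at the anchor from a plus certificate at any square-free sibling -/

section Sibling

variable (W : WeierstrassCurve ℚ) [W.IsElliptic] [W.IsGloballyMinimal] [NeZero (W.conductorNorm ℤ)]
  {fW : CuspForm (Gamma0 (W.conductorNorm ℤ)) 2}
  {d₁ : ℤ} {A₁ : WeierstrassCurve ℚ} [A₁.IsElliptic] [A₁.IsGloballyMinimal] [NeZero (A₁.conductorNorm ℤ)]
  {f₁ : CuspForm (Gamma0 (A₁.conductorNorm ℤ)) 2}

/-- **SIBLING ⟹ ANCHOR, either sign, the class `d₁ (mod 4)` derived.** `W/ℚ` globally minimal, good supersingular at `2`,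
`Δ(W) < 0`, newform `f_W`; `A₁ = C₁ • W^{(d₁)}` globally minimal and GOOD AT `2`, `d₁` square-free with `(d₁, N_W) = 1`, newform
`f₁` carrying the plus certificate «some `[b/4^k]⁺_{f₁} − [0]⁺_{f₁}` (`k ≥ 1`, `b` odd) is half an odd integer». Granted
modularity and Abbes–Ullmo: if `d₁ > 0` the plus certificate holds at `f_W` (`FlatTwist.Squarefree.exists_odd_of_exists_odd_twist`),
if `d₁ < 0` the minus certificate «some `2[b/4^k]⁻_{f_W}` is odd» holds at `f_W`
(`FlatTwist.Imaginary.exists_oddMinus_of_exists_odd_negTwist_squarefree`, H⁻(W) from Abbes–Ullmo); `d₁ ≡ 1 (mod 4)` is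
`emod_four_eq_one_of_hasGoodReductionAtPrime_two`. [cite: MazurTateTeitelbaum1986Invent, §I.8] [cite: Pal2012, Thm. 3.2]
[cite: BarriosEtAl2025, Thm. 5.1, rows I₀] [cite: AbbesUllmo1996, Thm. A] -/
theorem certificates_of_sibling (hmod : exists_isNewformOf) (hAU : abbesUllmo_not_dvd_maninConstant_of_not_dvd_level)
    (hss : GoodSS W 2) (hΔ : W.Δ < 0) (hfW : IsNewformOf W fW)
    (hsq₁ : Squarefree d₁) (hcop₁ : IsCoprime d₁ (W.conductorNorm ℤ : ℤ)) {C₁ : VariableChange ℚ}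
    (hA₁ : C₁ • W.quadraticTwist (d₁ : ℚ) = A₁) (hgood₁ : A₁.HasGoodReductionAtPrime 2) (hf₁ : IsNewformOf A₁ f₁)
    (hres₁ : ∃ k : ℕ, 1 ≤ k ∧ ∃ b : ℤ, Odd b ∧ ∃ m : ℤ, Odd m ∧
      ratPlusSymbol f₁ ((b : ℚ) / 4 ^ k) = ratPlusSymbol f₁ 0 + (m : ℚ) / 2) :
    (0 < d₁ → ∃ k : ℕ, 1 ≤ k ∧ ∃ b : ℤ, Odd b ∧ ∃ m : ℤ, Odd m ∧
        ratPlusSymbol fW ((b : ℚ) / 4 ^ k) = ratPlusSymbol fW 0 + (m : ℚ) / 2) ∧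
      (d₁ < 0 → ∃ k : ℕ, 1 ≤ k ∧ ∃ b : ℤ, Odd b ∧ ∃ m : ℤ, Odd m ∧
        2 * ratMinusSymbol fW ((b : ℚ) / 4 ^ k) = m) := by
  have hd4 : d₁ % 4 = 1 := emod_four_eq_one_of_hasGoodReductionAtPrime_two W hsq₁ hA₁ hss.1 hgood₁
  have h2 := SkinnerUrban2014.realPeriodRat_eq_unit_mul_plusPeriod_two_fact_of_abbesUllmo hAU
  refine ⟨fun hd ↦ ?_, fun hd ↦ ?_⟩
  · exact FlatTwist.Squarefree.exists_odd_of_exists_odd_twist W hmod h2 hss hd hd4 hsq₁ hcop₁ hA₁ hfW hf₁ hres₁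
  · obtain ⟨ϖ, hϖ1, hϖ⟩ := FlatTwist.Imaginary.exists_minusUnit_of_abbesUllmo W hAU hss hΔ fW hfW
    exact FlatTwist.Imaginary.exists_oddMinus_of_exists_odd_negTwist_squarefree W hmod h2 hss hΔ hd hd4 hsq₁ hcop₁ hA₁
      hfW hf₁ hϖ1 hϖ hres₁

/-- **For a SQUARE conductor, a RANK-ZERO sibling carries exactly the certificate the family node asks for.** Same setting with
`N_W` a perfect square and `L(A₁,1) ≠ 0`: then `w(A₁) = +1 = sign(d₁)·w(W)` (`rootNumber_twist_eq_of_isSquare`), so the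
sibling's plus certificate yields the plus certificate at `f_W` when `w(W) = +1` and the minus certificate at `f_W` when
`w(W) = −1`. [cite: MurtyMurty1997, Ch. 6 §1] [cite: Pal2012, Thm. 3.2] [cite: AbbesUllmo1996, Thm. A] -/
theorem rootNumber_certificates_of_sibling (hmod : exists_isNewformOf)
    (hAU : abbesUllmo_not_dvd_maninConstant_of_not_dvd_level)
    (hss : GoodSS W 2) (hΔ : W.Δ < 0) (hfW : IsNewformOf W fW) (hN : IsSquare (W.conductorNorm ℤ))
    (hsq₁ : Squarefree d₁) (hcop₁ : IsCoprime d₁ (W.conductorNorm ℤ : ℤ)) {C₁ : VariableChange ℚ}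
    (hA₁ : C₁ • W.quadraticTwist (d₁ : ℚ) = A₁) (hgood₁ : A₁.HasGoodReductionAtPrime 2) (hf₁ : IsNewformOf A₁ f₁)
    (hL₁ : A₁.entireLFunction 1 ≠ 0)
    (hres₁ : ∃ k : ℕ, 1 ≤ k ∧ ∃ b : ℤ, Odd b ∧ ∃ m : ℤ, Odd m ∧
      ratPlusSymbol f₁ ((b : ℚ) / 4 ^ k) = ratPlusSymbol f₁ 0 + (m : ℚ) / 2) :
    (W.rootNumber = 1 → ∃ k : ℕ, 1 ≤ k ∧ ∃ b : ℤ, Odd b ∧ ∃ m : ℤ, Odd m ∧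
        ratPlusSymbol fW ((b : ℚ) / 4 ^ k) = ratPlusSymbol fW 0 + (m : ℚ) / 2) ∧
      (W.rootNumber = -1 → ∃ k : ℕ, 1 ≤ k ∧ ∃ b : ℤ, Odd b ∧ ∃ m : ℤ, Odd m ∧
        2 * ratMinusSymbol fW ((b : ℚ) / 4 ^ k) = m) := by
  have hd4 : d₁ % 4 = 1 := emod_four_eq_one_of_hasGoodReductionAtPrime_two W hsq₁ hA₁ hss.1 hgood₁
  have hw₁ : A₁.rootNumber = 1 := WeierstrassCurve.rootNumber_eq_one_of_entireLFunction_one_ne_zero hL₁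
  obtain ⟨hpos, hneg⟩ := rootNumber_twist_eq_of_isSquare W hmod hd4 hsq₁ hcop₁ hN hA₁
  obtain ⟨hplus, hminus⟩ := certificates_of_sibling W hmod hAU hss hΔ hfW hsq₁ hcop₁ hA₁ hgood₁ hf₁ hres₁
  have hd0 : d₁ ≠ 0 := hsq₁.ne_zero
  refine ⟨fun hw ↦ hplus ?_, fun hw ↦ hminus ?_⟩
  · by_contra hle
    have hd : d₁ < 0 := lt_of_le_of_ne (not_lt.mp hle) hd0
    have h := hneg hd
    rw [hw₁, hw] at h
    omega
  · by_contra hle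
    have hd : 0 < d₁ := lt_of_le_of_ne (not_lt.mp hle) (Ne.symm hd0)
    have h := hpos hd
    rw [hw₁, hw] at h
    omega

end Sibling

/-! ## §2. The family node from sibling certificates -/

section Family

variable {p : ℕ} (W W' : WeierstrassCurve ℚ) [W.IsElliptic] [W.IsGloballyMinimal] [W'.IsElliptic] [W'.IsGloballyMinimal]
  [NeZero (W.conductorNorm ℤ)] [NeZero (W'.conductorNorm ℤ)]
  {fW : CuspForm (Gamma0 (W.conductorNorm ℤ)) 2} {fW' : CuspForm (Gamma0 (W'.conductorNorm ℤ)) 2}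
  {d₁ : ℤ} {A₁ : WeierstrassCurve ℚ} [A₁.IsElliptic] [A₁.IsGloballyMinimal] [NeZero (A₁.conductorNorm ℤ)]
  {f₁ : CuspForm (Gamma0 (A₁.conductorNorm ℤ)) 2}
  {d₂ : ℤ} {A₂ : WeierstrassCurve ℚ} [A₂.IsElliptic] [A₂.IsGloballyMinimal] [NeZero (A₂.conductorNorm ℤ)]
  {f₂ : CuspForm (Gamma0 (A₂.conductorNorm ℤ)) 2}

/-- **THE FAMILY NODE FROM SIBLINGS.** Prime `p`, `q = ±p`; anchor pair `W`, `W′ = C′ • W^{(q)}` (globally minimal, good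
supersingular at `2` with `a₂ = 0`, `Δ < 0`, conductor `p²`, newforms `f_W`, `f_{W′}`, `j(W) ≠ 0, 1728`); SIBLINGS:
`A₁ = C₁ • W^{(d₁)}` and `A₂ = C₂ • W′^{(d₂)}` globally minimal, good at `2`, `d_i` square-free with `p ∤ d_i`, of analytic
rank `0` (`L(A_i,1) ≠ 0`), newforms `f₁`, `f₂`, EACH carrying a plus certificate. Granted modularity and Abbes–Ullmo: (μ♭)
at EVERY globally minimal `A` with `j(A) = j(W)`, good at `2`, `L(A,1) ≠ 0`, every newform `f_A`, every Pollack pair.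
(`analyticMuFlat_of_j_eq` with the anchors' certificates supplied by `rootNumber_certificates_of_sibling`.) BSD is not proved
by this. [cite: SilvermanAEC2009, X.5 Prop. 5.4] [cite: BarriosEtAl2025, Thm. 5.1, rows I₀] [cite: MurtyMurty1997, Ch. 6 §1]
[cite: Pal2012, Thm. 3.2] [cite: AbbesUllmo1996, Thm. A] [cite: Pollack2003, Prop. 6.18] -/
theorem analyticMuFlat_of_j_eq_of_siblings (hmod : exists_isNewformOf)
    (hAU : abbesUllmo_not_dvd_maninConstant_of_not_dvd_level) (hp : p.Prime) {q : ℤ} (hq : q = p ∨ q = -(p : ℤ))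
    (hss : GoodSS W 2) (haW : W.frobeniusTrace 2 = 0) (hΔ : W.Δ < 0) (hj0 : W.j ≠ 0) (hj1728 : W.j ≠ 1728)
    (hNW : W.conductorNorm ℤ = p ^ 2) (hfW : IsNewformOf W fW)
    (hsq₁ : Squarefree d₁) (hpd₁ : ¬ (p : ℤ) ∣ d₁) {C₁ : VariableChange ℚ} (hA₁ : C₁ • W.quadraticTwist (d₁ : ℚ) = A₁)
    (hgood₁ : A₁.HasGoodReductionAtPrime 2) (hf₁ : IsNewformOf A₁ f₁) (hL₁ : A₁.entireLFunction 1 ≠ 0)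
    (hres₁ : ∃ k : ℕ, 1 ≤ k ∧ ∃ b : ℤ, Odd b ∧ ∃ m : ℤ, Odd m ∧
      ratPlusSymbol f₁ ((b : ℚ) / 4 ^ k) = ratPlusSymbol f₁ 0 + (m : ℚ) / 2)
    {C' : VariableChange ℚ} (hW' : C' • W.quadraticTwist (q : ℚ) = W')
    (hss' : GoodSS W' 2) (haW' : W'.frobeniusTrace 2 = 0) (hΔ' : W'.Δ < 0)
    (hNW' : W'.conductorNorm ℤ = p ^ 2) (hfW' : IsNewformOf W' fW')
    (hsq₂ : Squarefree d₂) (hpd₂ : ¬ (p : ℤ) ∣ d₂) {C₂ : VariableChange ℚ} (hA₂ : C₂ • W'.quadraticTwist (d₂ : ℚ) = A₂)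
    (hgood₂ : A₂.HasGoodReductionAtPrime 2) (hf₂ : IsNewformOf A₂ f₂) (hL₂ : A₂.entireLFunction 1 ≠ 0)
    (hres₂ : ∃ k : ℕ, 1 ≤ k ∧ ∃ b : ℤ, Odd b ∧ ∃ m : ℤ, Odd m ∧
      ratPlusSymbol f₂ ((b : ℚ) / 4 ^ k) = ratPlusSymbol f₂ 0 + (m : ℚ) / 2)
    {A : WeierstrassCurve ℚ} [A.IsElliptic] [A.IsGloballyMinimal] [NeZero (A.conductorNorm ℤ)]
    {fA : CuspForm (Gamma0 (A.conductorNorm ℤ)) 2}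
    (hjA : A.j = W.j) (hgoodA : A.HasGoodReductionAtPrime 2) (hfA : IsNewformOf A fA)
    (hLA : A.entireLFunction 1 ≠ 0) (Lplus Lminus : IwasawaAlgebra 2) (hPP : IsPollackPair fA 2 Lplus Lminus) :
    ∃ n : ℕ, IsUnit (PowerSeries.coeff n (kobayashiL 1 Lplus Lminus)) := by
  have hN : IsSquare (W.conductorNorm ℤ) := ⟨p, by rw [hNW, sq]⟩
  have hN' : IsSquare (W'.conductorNorm ℤ) := ⟨p, by rw [hNW', sq]⟩
  have hcop₁ : IsCoprime d₁ (W.conductorNorm ℤ : ℤ) := isCoprime_natCast_of_not_dvd_of_eq_sq hp hpd₁ hNW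
  have hcop₂ : IsCoprime d₂ (W'.conductorNorm ℤ : ℤ) := isCoprime_natCast_of_not_dvd_of_eq_sq hp hpd₂ hNW'
  obtain ⟨h1p, h1m⟩ :=
    rootNumber_certificates_of_sibling W hmod hAU hss hΔ hfW hN hsq₁ hcop₁ hA₁ hgood₁ hf₁ hL₁ hres₁
  obtain ⟨h2p, h2m⟩ :=
    rootNumber_certificates_of_sibling W' hmod hAU hss' hΔ' hfW' hN' hsq₂ hcop₂ hA₂ hgood₂ hf₂ hL₂ hres₂
  exact analyticMuFlat_of_j_eq W W' hmod hAU hp hq hss haW hΔ hj0 hj1728 hNW hfW h1p h1m hW' hss' haW' hΔ' hNW' hfW'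
    h2p h2m hjA hgoodA hfA hLA Lplus Lminus hPP

/-! ## §3. From print: unit-zone siblings -/

/-- **FLAT ON A WHOLE `j`-FAMILY FROM PRINT AND TWO UNIT-ZONE MEMBERS.** Grant BY NAME Burungale–Flach (`hBF`), modularity
(`hmod`, `hLrat`), GZK (`hGZK`) and Abbes–Ullmo (`hAU`, which also yields the period unit at `2`). Anchor pair `W`,
`W′ = C′ • W^{(q)}` (`q = ±p`; globally minimal, good supersingular at `2` with `a₂ = 0`, `Δ < 0`, conductor `p²`,
`j(W) ≠ 0, 1728`). UNIT-ZONE SIBLINGS: `A₁ = C₁ • W^{(d₁)}` and `A₂ = C₂ • W′^{(d₂)}` globally minimal, CM, good supersingular at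
`2`, of analytic rank `0`, `d_i` square-free with `p ∤ d_i`, with `2 ∤ #Ш(A_i)·∏c_ℓ(A_i)` — their plus certificates come from
the unit zone (`FlatTwist.exists_odd_of_unitZone`, `a₂(A_i) = ±a₂ = 0` by the twisting formula). THEN the registered stub
`stub_analyticMuFlatNonUnitCMTwo` (= FLAT) holds RESTRICTED TO THE FAMILY `j(A) = j(W)` — its binders verbatim after
`A.j = W.j →`. So on a sporadic CM family FLAT at all conductors costs print plus the (odd) BSD data of two rank-`0` members;
no modular-symbol numerics. Nothing about any particular curve is asserted; BSD is not proved by this.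
[cite: BurungaleFlach2024, Thm. 1.1] [cite: SilvermanAEC2009, X.5 Prop. 5.4] [cite: BarriosEtAl2025, Thm. 5.1, rows I₀]
[cite: AbbesUllmo1996, Thm. A] [cite: Pollack2003, Prop. 6.18] [cite: Kobayashi2003, Thm. 1.2] -/
theorem analyticMuFlat_family_of_pub_of_unitZone_siblings
    (hBF : bsdTriple_of_hasCM_of_L_one_ne_zero) (hmod : nonempty_modularParametrizationData)
    (hLrat : hasEntireLFunction_rat) (hGZK : rank_eq_analyticRank_of_analyticRank_le_one)
    (hAU : abbesUllmo_not_dvd_maninConstant_of_not_dvd_level) (hp : p.Prime) {q : ℤ} (hq : q = p ∨ q = -(p : ℤ))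
    (hss : GoodSS W 2) (haW : W.frobeniusTrace 2 = 0) (hΔ : W.Δ < 0) (hj0 : W.j ≠ 0) (hj1728 : W.j ≠ 1728)
    (hNW : W.conductorNorm ℤ = p ^ 2) (hfW : IsNewformOf W fW)
    (hsq₁ : Squarefree d₁) (hpd₁ : ¬ (p : ℤ) ∣ d₁) {C₁ : VariableChange ℚ} (hA₁ : C₁ • W.quadraticTwist (d₁ : ℚ) = A₁)
    (hcm₁ : A₁.HasCM) (hr₁ : A₁.analyticRank = 0) (hss₁ : GoodSS A₁ 2) (hunit₁ : ¬ 2 ∣ A₁.shaOrder * A₁.tamagawaProduct)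
    {C' : VariableChange ℚ} (hW' : C' • W.quadraticTwist (q : ℚ) = W')
    (hss' : GoodSS W' 2) (haW' : W'.frobeniusTrace 2 = 0) (hΔ' : W'.Δ < 0)
    (hNW' : W'.conductorNorm ℤ = p ^ 2) (hfW' : IsNewformOf W' fW')
    (hsq₂ : Squarefree d₂) (hpd₂ : ¬ (p : ℤ) ∣ d₂) {C₂ : VariableChange ℚ} (hA₂ : C₂ • W'.quadraticTwist (d₂ : ℚ) = A₂)
    (hcm₂ : A₂.HasCM) (hr₂ : A₂.analyticRank = 0) (hss₂ : GoodSS A₂ 2) (hunit₂ : ¬ 2 ∣ A₂.shaOrder * A₂.tamagawaProduct) :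
    ∀ (A : WeierstrassCurve ℚ) [A.IsElliptic] [A.IsGloballyMinimal], A.j = W.j → A.HasCM → A.analyticRank = 0 →
      GoodSS A 2 → A.frobeniusTrace 2 = 0 → 2 ∣ A.shaOrder * A.tamagawaProduct →
      ∀ [NeZero (A.conductorNorm ℤ)] (f : CuspForm (Gamma0 (A.conductorNorm ℤ)) 2), IsNewformOf A f →
        ∀ (Lplus Lminus : IwasawaAlgebra 2), IsPollackPair f 2 Lplus Lminus →
          ∃ n : ℕ, IsUnit (PowerSeries.coeff n (kobayashiL 1 Lplus Lminus)) := by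
  intro A _ _ hjA _ hrA hssA _ _ _ f hf Lplus Lminus hPP
  have hmod' : exists_isNewformOf := exists_isNewformOf_of_nonempty_modularParametrizationData hmod
  have h2 := SkinnerUrban2014.realPeriodRat_eq_unit_mul_plusPeriod_two_fact_of_abbesUllmo hAU
  have hLA : A.entireLFunction 1 ≠ 0 := (A.analyticRank_eq_zero_iff_holds (hLrat A)).mp hrA
  have hL₁ : A₁.entireLFunction 1 ≠ 0 := (A₁.analyticRank_eq_zero_iff_holds (hLrat A₁)).mp hr₁
  have hL₂ : A₂.entireLFunction 1 ≠ 0 := (A₂.analyticRank_eq_zero_iff_holds (hLrat A₂)).mp hr₂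
  have hcop₁ : IsCoprime d₁ (W.conductorNorm ℤ : ℤ) := isCoprime_natCast_of_not_dvd_of_eq_sq hp hpd₁ hNW
  have hcop₂ : IsCoprime d₂ (W'.conductorNorm ℤ : ℤ) := isCoprime_natCast_of_not_dvd_of_eq_sq hp hpd₂ hNW'
  -- `a₂(A₁) = ±a₂(W) = 0`, `a₂(A₂) = ±a₂(W′) = 0` (twisting formula at the good prime `2 ∤ d_i`)
  have hd4₁ : d₁ % 4 = 1 := emod_four_eq_one_of_hasGoodReductionAtPrime_two W hsq₁ hA₁ hss.1 hss₁.1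
  have hd4₂ : d₂ % 4 = 1 := emod_four_eq_one_of_hasGoodReductionAtPrime_two W' hsq₂ hA₂ hss'.1 hss₂.1
  have ha₁ : A₁.frobeniusTrace 2 = 0 := by
    have h2d₁ : ¬ (2 : ℤ) ∣ d₁ := by omega
    rw [(hasGoodReductionAtPrime_twist_and_frobeniusTrace_eq W 2 hmod' hd4₁ hsq₁ hcop₁ hA₁ hss.1 h2d₁).2, haW,
      mul_zero]
  have ha₂ : A₂.frobeniusTrace 2 = 0 := by
    have h2d₂ : ¬ (2 : ℤ) ∣ d₂ := by omega
    rw [(hasGoodReductionAtPrime_twist_and_frobeniusTrace_eq W' 2 hmod' hd4₂ hsq₂ hcop₂ hA₂ hss'.1 h2d₂).2, haW',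
      mul_zero]
  obtain ⟨f₁, hf₁⟩ := hmod' A₁
  obtain ⟨f₂, hf₂⟩ := hmod' A₂
  have hres₁ := FlatTwist.exists_odd_of_unitZone A₁ hBF hLrat hGZK h2 hcm₁ hr₁ hss₁ ha₁ hunit₁ hf₁
  have hres₂ := FlatTwist.exists_odd_of_unitZone A₂ hBF hLrat hGZK h2 hcm₂ hr₂ hss₂ ha₂ hunit₂ hf₂
  exact analyticMuFlat_of_j_eq_of_siblings W W' hmod' hAU hp hq hss haW hΔ hj0 hj1728 hNW hfW hsq₁ hpd₁ hA₁ hss₁.1 hf₁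
    hL₁ hres₁ hW' hss' haW' hΔ' hNW' hfW' hsq₂ hpd₂ hA₂ hss₂.1 hf₂ hL₂ hres₂ hjA hssA.1 hf hLA Lplus Lminus hPP

end Family

/-! ## §4. Prime-power conductor (not a square): both certificates at each anchor -/

section PrimePower

variable {p k : ℕ} (W W' : WeierstrassCurve ℚ) [W.IsElliptic] [W.IsGloballyMinimal] [W'.IsElliptic] [W'.IsGloballyMinimal]
  [NeZero (W.conductorNorm ℤ)] [NeZero (W'.conductorNorm ℤ)]
  {fW : CuspForm (Gamma0 (W.conductorNorm ℤ)) 2} {fW' : CuspForm (Gamma0 (W'.conductorNorm ℤ)) 2}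

/-- Coprimality to `N = p^k` from `p ∤ d`. [folklore] -/
theorem isCoprime_natCast_of_not_dvd_of_eq_pow (hp : p.Prime) {d : ℤ} (hpd : ¬ (p : ℤ) ∣ d) {N : ℕ}
    (hN : N = p ^ k) : IsCoprime d (N : ℤ) := by
  rw [hN]; push_cast
  exact (((Prime.coprime_iff_not_dvd (Nat.prime_iff_prime_int.mp hp)).mpr hpd).symm).pow_right

/-- **THE FAMILY NODE FOR PRIME-POWER CONDUCTOR `N = p^k` (e.g. `27 = 3³`, the `j = −2¹⁵·3·5³` family of `27a`), BOTH
certificates at each anchor.** As `analyticMuFlat_of_j_eq`, but `N_W = N_{W′} = p^k` need not be a square, so both signs of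
the twist parameter may occur in analytic rank `0` and each anchor carries BOTH its plus and its minus certificate. Granted
modularity and Abbes–Ullmo: (μ♭) at EVERY globally minimal `A` with `j(A) = j(W)`, good at `2`, `L(A,1) ≠ 0`, every newform,
every Pollack pair. BSD is not proved by this. [cite: SilvermanAEC2009, X.5 Prop. 5.4] [cite: BarriosEtAl2025, Thm. 5.1, rows I₀]
[cite: MazurTateTeitelbaum1986Invent, §I.8] [cite: Pal2012, Thm. 3.2] [cite: AbbesUllmo1996, Thm. A] [cite: Pollack2003, Prop. 6.18] -/
theorem analyticMuFlat_of_j_eq_of_both_certificates (hmod : exists_isNewformOf)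
    (hAU : abbesUllmo_not_dvd_maninConstant_of_not_dvd_level) (hp : p.Prime) {q : ℤ} (hq : q = p ∨ q = -(p : ℤ))
    (hss : GoodSS W 2) (haW : W.frobeniusTrace 2 = 0) (hΔ : W.Δ < 0) (hj0 : W.j ≠ 0) (hj1728 : W.j ≠ 1728)
    (hNW : W.conductorNorm ℤ = p ^ k) (hfW : IsNewformOf W fW)
    (hWplus : ∃ k : ℕ, 1 ≤ k ∧ ∃ b : ℤ, Odd b ∧ ∃ m : ℤ, Odd m ∧
      ratPlusSymbol fW ((b : ℚ) / 4 ^ k) = ratPlusSymbol fW 0 + (m : ℚ) / 2)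
    (hWminus : ∃ k : ℕ, 1 ≤ k ∧ ∃ b : ℤ, Odd b ∧ ∃ m : ℤ, Odd m ∧ 2 * ratMinusSymbol fW ((b : ℚ) / 4 ^ k) = m)
    {C' : VariableChange ℚ} (hW' : C' • W.quadraticTwist (q : ℚ) = W')
    (hss' : GoodSS W' 2) (haW' : W'.frobeniusTrace 2 = 0) (hΔ' : W'.Δ < 0)
    (hNW' : W'.conductorNorm ℤ = p ^ k) (hfW' : IsNewformOf W' fW')
    (hW'plus : ∃ k : ℕ, 1 ≤ k ∧ ∃ b : ℤ, Odd b ∧ ∃ m : ℤ, Odd m ∧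
      ratPlusSymbol fW' ((b : ℚ) / 4 ^ k) = ratPlusSymbol fW' 0 + (m : ℚ) / 2)
    (hW'minus : ∃ k : ℕ, 1 ≤ k ∧ ∃ b : ℤ, Odd b ∧ ∃ m : ℤ, Odd m ∧ 2 * ratMinusSymbol fW' ((b : ℚ) / 4 ^ k) = m)
    {A : WeierstrassCurve ℚ} [A.IsElliptic] [A.IsGloballyMinimal] [NeZero (A.conductorNorm ℤ)]
    {fA : CuspForm (Gamma0 (A.conductorNorm ℤ)) 2}
    (hjA : A.j = W.j) (hgoodA : A.HasGoodReductionAtPrime 2) (hfA : IsNewformOf A fA)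
    (hLA : A.entireLFunction 1 ≠ 0) (Lplus Lminus : IwasawaAlgebra 2) (hPP : IsPollackPair fA 2 Lplus Lminus) :
    ∃ n : ℕ, IsUnit (PowerSeries.coeff n (kobayashiL 1 Lplus Lminus)) := by
  obtain ⟨d, hsq, C, hA⟩ := exists_squarefree_twist_of_j_eq hjA hj0 hj1728
  by_cases hpd : (p : ℤ) ∣ d
  · -- `p ∣ d`: route through the second anchor, `d = q e`
    obtain ⟨k₀, hk⟩ := hpd
    obtain ⟨e, hde⟩ : ∃ e : ℤ, d = q * e := by
      rcases hq with rfl | rfl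
      · exact ⟨k₀, hk⟩
      · exact ⟨-k₀, by rw [hk]; ring⟩
    have hsqe : Squarefree e := Squarefree.squarefree_of_dvd ⟨q, by rw [hde]; ring⟩ hsq
    have hpe : ¬ (p : ℤ) ∣ e := by
      rintro ⟨m, hm⟩
      have hpp : (p : ℤ) * p ∣ d := by
        rcases hq with rfl | rfl
        · exact ⟨m, by rw [hde, hm]; ring⟩
        · exact ⟨-m, by rw [hde, hm]; ring⟩
      have hu : IsUnit (p : ℤ) := hsq (p : ℤ) hpp
      have h1 := hp.one_lt
      rcases Int.isUnit_iff.mp hu with h | h <;> omega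
    have hcop : IsCoprime e (W'.conductorNorm ℤ : ℤ) := isCoprime_natCast_of_not_dvd_of_eq_pow hp hpe hNW'
    have htw : W'.quadraticTwist (e : ℚ) =
        (⟨C'.u, (e : ℚ) * C'.r, 0, 0⟩ : VariableChange ℚ) • W.quadraticTwist (d : ℚ) := by
      rw [← hW', quadraticTwist_smul, quadraticTwist_quadraticTwist]
      congr 2
      rw [hde]; push_cast; ring
    have hA' : (C * (⟨C'.u, (e : ℚ) * C'.r, 0, 0⟩ : VariableChange ℚ)⁻¹) • W'.quadraticTwist (e : ℚ) = A := by
      rw [mul_smul, htw, inv_smul_smul, hA]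
    exact analyticMuFlat_twist_at_of_certificates W' hmod hAU hss' haW' hΔ' hfW' (fun _ ↦ hW'plus) (fun _ ↦ hW'minus)
      hsqe hcop hA' hgoodA hfA hLA Lplus Lminus hPP
  · have hcop : IsCoprime d (W.conductorNorm ℤ : ℤ) := isCoprime_natCast_of_not_dvd_of_eq_pow hp hpd hNW
    exact analyticMuFlat_twist_at_of_certificates W hmod hAU hss haW hΔ hfW (fun _ ↦ hWplus) (fun _ ↦ hWminus) hsq hcop
      hA hgoodA hfA hLA Lplus Lminus hPP

end PrimePower

end Summit.BirchSwinnertonDyer.BirchSwinnertonDyer.Theorems.FlatTwist.Family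

end
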